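import Summits.Langlands.Langlands.Theses.PhantomRMYoshida
import Literature.NumberTheory.Automorphic.SerreConjectureProofs
import Literature.NumberTheory.GaloisRepresentations.SerreWeightLowerBoundProofs
import Literature.NumberTheory.Automorphic.NewformAdelisationHeckeOperator
import Literature.NumberTheory.Automorphic.CuspidalRepDataOfCuspForm
import Literature.NumberTheory.Automorphic.NewformAdelisationArchCovariance
import Summits.Langlands.Langlands.Theorems.PhantomRMYoshidaSerreKWAutomorphicGL2ResidueAdaptedEmbedding
import Summits.Langlands.Langlands.Theorems.PhantomRMYoshidaSerreKWAutomorphicGL2ConjugateNewform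
import Summits.Langlands.Langlands.Theorems.PhantomRMYoshidaSerreKWAutomorphicGL2AdelicLiftIsCuspForm
import Summits.Langlands.Langlands.Theorems.PhantomRMYoshidaSerreKWAutomorphicGL2DictionaryL
import Summits.Langlands.Langlands.Theorems.PhantomRMYoshidaSerreKWAutomorphicGL2LoweringKillsLift
import Summits.Langlands.Langlands.Theorems.PhantomRMYoshidaSerreKWAutomorphicGL2ArchParameterOfGeneratedDatum

/-!
# Line `adelic-newform-datum-double-twist` — skeleton for crux `PhantomRMYoshida.SerreKWAutomorphicGL2`
# (stmt-Langlands-12944, route-Langlands-PhantomRMYoshida; crux-plan round 1, RESHAPED by the line lead 2026-08-16)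

**Idea** (crux-idea card `adelic-newform-datum-double-twist`, ideator 1; triage r1: pass ×3,
merge ≈ `cyclic-bj-datum-adelic-newform` ≈ `lowest-weight-casimir-dictionary` K1+K2 on the
automorphic half).  The crux is Serre's conjecture for `GL₂/ℚ` read in the summit's automorphic
L-normalisation.  Its content splits as

* (A) GALOIS SIDE = Khare–Wintenberger (in the tree: the named fact `khare_wintenberger p k`,
  strong form, `∃ ι_f : 𝓞_f →+* k` INSIDE) + ALIGNMENT of KW's hidden residual coefficient map
  `ι_f` with the crux's prescribed pair `(ι : ℚ̄_p ≃ ℂ, red : 𝒪_{ℚ̄_p} → k)` — a residue-adapted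
  embedding `θ : 𝓞_f → 𝒪_{ℚ̄_p}` with `red ∘ θ = ι_f` (pure algebraic number theory) and the
  Galois-CONJUGATE newform `f^τ`, `τ = ι ∘ θ` (Diamond–Shurman Thm. 6.5.4);
* (B) AUTOMORPHIC SIDE = the LEVER of the card: the Borel–Jacquet datum GENERATED by the adelic
  lift `φ_g = adelicLiftFunA M w g` of the (conjugate) newform `g`
  (`CuspidalAutomorphicRepData.ofCuspForm`), whose unramified Hecke eigenvalues are PROVED in the
  tree (`heckeOperator_principalCongruenceLevel_adelicLiftFunA_one/two`: unitary Satake pair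
  `{α, β}`, `(√q)^{w-1}(α + β) = a_q`, `αβ = ε(q)`) and whose Harish-Chandra parameter is
  `{(w-1)/2, (1-w)/2}` (lowest-weight vector, `GL2CasimirParameter`), normalised by the DOUBLE
  TWIST `π ⊗ (ofDirichlet ε)⁻¹∘det ⊗ |det|^{(w-1)/2}`: the finite-order twist INVERTS the Satake
  pair (`{α, β}·ε(q)⁻¹ = {β⁻¹, α⁻¹}`, no contragredient, no Ramanujan), the norm twist makes the
  infinity type `{(w-1, 0), (0, w-1)}` — L-algebraic for EVERY `w` — and the Satake multiset the
  INVERTED ROOTS of the Hecke polynomial `H = X² - a_q X + ε(q) q^{w-1}`, so that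
  `arithFrobPolyOfSatake ι q 1 (H.roots.map (·⁻¹)) = H.map ι⁻¹` TERMWISE
  (`arithFrobPolyOfSatake_one_rootsInv`, proved below) — literally the polynomial that
  `IsGaloisRepOfNewform1Int` (the conclusion of `khare_wintenberger`) reduces to `charpoly σ̄(Frob_q)`.

**Shape.** `SerreKWAutomorphicGL2_of : SerreKWAutomorphicGL2` (no hypotheses) is proved at the
end of this file from seven `stub_*` theorems (one of them the named fact, six proof obligations) by
REAL glue (integrality transport of the KW polynomial along `θ`, polynomial-map bookkeeping, the
root-form identity, and the three cofinite exceptional sets `q ∣ Np`, `q ∣ NM`, the twist's bad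
places); `sorry` occurs only inside the stubs; stub statements mention only Mathlib and
`Literature.*` declarations (no local definition), so each can land as
`Theorems/SerreKWAutomorphicGL2<Stub>.lean` with `--supports stmt-Langlands-12944`.

* `stub_khareWintenberger` — THE NAMED-FACT INPUT (not a proof obligation): the tree's named fact
  `khare_wintenberger p k` (Serre's conjecture, strong form, KW-I Thm. 1.2 + 9.1 with Kisin 2009)
  for all `p, k`, VERBATIM.  It is consumed only through the sorry-free re-indexing
  `serreModularityTwoLe_of_khareWintenberger` (weak form with Serre's bound `2 ≤ k(σ̄)`:
  `nonempty_localRestrictionAt`, `nonempty_ringHom_residue`, `two_le_serreWeightLocal_holds`).  It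
  is registered as a stub only because the skeleton audit admits no named-fact hypothesis on
  `<Crux>_of`; the lead closes the line by deleting it and taking
  `(hKW : ∀ p …, khare_wintenberger p k)` as the ONE hypothesis of the final theorem
  (`proof.conditional` on KW — the minimum possible, triage r1-2/3).  Trust base = {KW}: no new
  Literature fact (triage: drop the card's stub A1 `serre_wrt_embedding`).
* `stub_residueAdaptedEmbedding` (M; pure algebra, provable now) — lever (A): every `j : 𝓞_f → k`
  is `red ∘ θ` for an embedding `θ : 𝓞_f → 𝒪_{ℚ̄_p}` of the shape `ι⁻¹ ∘ τ`, `τ : K_f → ℂ`.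
* `stub_conjugateNewform` (M–L; classical, provable now) — Galois-conjugate eigenpackets of
  newforms are newform eigenpackets (DS Thm. 6.5.4 via the PROVED `Γ₁` integral lattice).
* `stub_loweringKillsLift` (M; classical analysis) — `φ_f` is smooth in the archimedean variable
  and killed by the lowering operator along `ι_𝔸` (Cauchy–Riemann read in the group).  RESHAPE by
  the lead (2026-08-16): verbatim the sibling line `lowest-weight-casimir-dictionary`'s registered
  stub 1, made an explicit input so that the Cauchy–Riemann / Casimir computation is done ONCE.
* `stub_adelicLiftIsCuspForm` (L; classical analysis) — from Stub 4's two conclusions,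
  `φ_f ∈ 𝒜₀(GL₂)`: Borel–Jacquet 4.2 conditions for the defined lift + the cusp condition at
  function level (`Z(𝔤)`-finiteness via the landed `Rat.isZFinite_of_casimir_of_zed`).
* `stub_archParameterOfGeneratedDatum` (L; the dictionary proper, archimedean half; HARDEST, held
  by the lead) — from `X φ_f = 0` and `φ_f ∈ 𝒜₀`: the datum generated by `φ_f` has Harish-Chandra
  parameter `{(w-1)/2, (1-w)/2}` (infinitesimal character by minimality of the stable closure).
* `stub_dictionaryL` (M/L; the dictionary proper, finite half + THE DOUBLE TWIST, assembly over the
  proved Hecke-operator and twist API) — RESHAPE: the former `stub_unitarySatakeOfGeneratedDatum` and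
  `stub_doubleTwist` merged into the sibling line's registered `stub_dictionaryL` (abstract cuspidal
  `π` with `φ_f ∈ W ∖ W'` and the archimedean parameter ⟹ an L-algebraic `π₂` with Satake
  multiset `H_v.roots⁻¹` a.e.), to keep the registered stub count at 7.

**Disproof used** (`Cruxes/SerreKWAutomorphicGL2/Disproof.lean`, cdisprove cycle 1, rc 0, read in
full; it is a workfile, not importable): it contains NO `_false_without_<H>` theorem and no
`-- Targets`, so there is no obstruction of that form to honour and no landed `Negative/` lemma to
import (none exists; `ledger negatives --problem Langlands` = 1 unrelated entry, K3 Kuga–Satake).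
What the stub set honours instead: §2 load-bearing analysis — `IsOdd` and `IsIrreducible` are
consumed EXACTLY ONCE, at the KW step (`stub_khareWintenberger` through
`serreModularityTwoLe_of_khareWintenberger`), never on the automorphic side; §3 `red_factors_through_residue` is the first step of `stub_residueAdaptedEmbedding`'s proof
(kernel of `red` = `𝔪`); `hcpt₂_inhabited` / `iota_inhabited` = non-vacuity of the quantifiers the
glue passes through; §4's convention-flip list (arithmetic Frobenius, sign of the half-twist,
nebentypus, `ι` vs residual embedding) is exactly what `stub_doubleTwist` + `stub_residueAdaptedEmbedding`
pin down, kernel-checked here by `arithFrobPolyOfSatake_one_rootsInv` and the glue.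
-/

noncomputable section

open scoped MatrixGroups Classical Polynomial
open NumberField IsDedekindDomain Filter Polynomial CongruenceSubgroup
open Literature.NumberTheory.Automorphic Literature.NumberTheory.EllipticCurves.ModularForms
  Literature.NumberTheory.GaloisRepresentations
  Literature.NumberTheory.GaloisRepresentations.ModPGaloisRep
  Literature.NumberTheory.GaloisRepresentations.IsNonarchimedeanLocalField

namespace Summit.Langlands.Langlands.Cruxes.SerreKWAutomorphicGL2.AdelicNewformDatumDoubleTwist

set_option linter.dupNamespace false
set_option linter.unusedVariables false

/-! ## Stub 1 — the NAMED-FACT INPUT: the tree's `khare_wintenberger`, verbatim -/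

/-- **Stub 1 (NAMED-FACT INPUT, not a proof obligation): Serre's modularity conjecture, strong form
(Khare–Wintenberger (I) Thm. 1.2 + Thm. 9.1, Hypothesis (H) = Kisin 2009), EXACTLY as vendored in
the tree** — the named fact `Literature.NumberTheory.Automorphic.khare_wintenberger p k`
(`= SerreModularityConjecture p k`: every continuous, irreducible, odd `σ̄ : Γ_ℚ → GL₂(k)`, `k`
algebraically closed of characteristic `p`, arises along some `ι_f : 𝓞_f →+* k` from a newform of
level `N(σ̄)` and weight `k(σ̄)`, `IsGaloisRepOfNewform1Int` away from `N(σ̄) p`), for all `p` and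
`k`.  It is the ONE unproved input of the line and is consumed only through the sorry-free
re-indexing `serreModularityTwoLe_of_khareWintenberger` below (weak form with Serre's bound
`2 ≤ k(σ̄)`).  It is registered as a stub only because the skeleton audit admits no named-fact
hypothesis on `<Crux>_of`; NOBODY is asked to prove it: the lead closes the line by deleting this
stub and taking `(hKW : ∀ p …, khare_wintenberger p k)` as the single hypothesis of the final theorem
(`proof.conditional` on KW — the minimum possible for this crux, triage r1-2/3).  Size: named fact
(XL in print; 0 lines owed here). [cite: KhareWintenberger2009, Thm. 1.2 and Thm. 9.1]
[cite: Kisin2009TwoAdic, Thm. 0.1, Cor. 0.2] -/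
theorem stub_khareWintenberger :
    ∀ (p : ℕ) [Fact p.Prime] (k : Type) [Field k] [TopologicalSpace k] [DiscreteTopology k],
      khare_wintenberger p k := by
  sorry

/-- **Serre's conjecture, weak form with the weight bound, from `khare_wintenberger`** (sorry-free
re-indexing of Stub 1; this is the shape the glue consumes).  For every prime `p`, every
algebraically closed discrete field `k` of characteristic `p` and every continuous, odd, irreducible
`σ̄ : Γ_ℚ → GL₂(k)` there are a level `N ≥ 1`, a weight `w ≥ 2`, a newform `f ∈ S_w(Γ₁(N))` and
`ι_f : 𝓞_f →+* k` with `σ̄` attached to `f` along `ι_f` away from `N p`: for every prime `q ∤ N p`,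
`σ̄` is unramified at `q` and `charpoly σ̄(Frob_q) = ι_f(P_q)`, `P_q ∈ 𝓞_f[X]` mapping to the Hecke
polynomial `X² - a_q(f) X + ε_f(q) q^{w-1}` (`IsGaloisRepOfNewform1Int`).  Proof: instantiate the
strong form at a local restriction datum at `p` (`nonempty_localRestrictionAt`) and a residue
embedding (`nonempty_ringHom_residue`), take `N = N(σ̄)`, `w = k(σ̄)`, and use Serre's lower bound
`2 ≤ k(σ̄)` (`ModPGaloisRep.two_le_serreWeightLocal_holds`, Serre 1987, §2.4 Remarque).
[cite: KhareWintenberger2009, Thm. 1.2 and Thm. 9.1] [cite: Serre1987, §2.4 Remarque (2 ≤ k)] -/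
theorem serreModularityTwoLe_of_khareWintenberger
    (hKW : ∀ (p : ℕ) [Fact p.Prime] (k : Type) [Field k] [TopologicalSpace k] [DiscreteTopology k],
      khare_wintenberger p k) :
    ∀ (p : ℕ) [Fact p.Prime] (k : Type) [Field k] [CharP k p] [IsAlgClosed k]
      [TopologicalSpace k] [DiscreteTopology k] (σ : FramedGaloisRep ℚ k 2),
      σ.IsOdd → σ.toGaloisRep.IsIrreducible →
      ∃ (N : ℕ) (_ : NeZero N) (w : ℕ), 2 ≤ w ∧
        ∃ (f : CuspForm (Gamma1 N) (w : ℤ)) (ιf : coeffCharIntegers f →+* k),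
          IsNewform1 f ∧ IsGaloisRepOfNewform1Int f ιf {q | q ∣ N * p} σ := by
  intro p _ k _ _ _ _ _ σ hodd hirr
  obtain ⟨loc⟩ := nonempty_localRestrictionAt (k := k) p σ
  obtain ⟨ι⟩ := nonempty_ringHom_residue (k := k) p loc.F loc.residueFieldCard_eq
  obtain ⟨f, ιf, hf, hρ⟩ := hKW p k σ hirr hodd loc ι
  have h2 := ModPGaloisRep.two_le_serreWeightLocal_holds loc.rep ι
  exact ⟨serreLevel p σ, _, serreWeight p σ loc ι, h2, f, ιf, hf, hρ⟩

/-! ## Stubs 2–3 — lever (A): LANDED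
`stub_residueAdaptedEmbedding` (Theorems/PhantomRMYoshidaSerreKWAutomorphicGL2ResidueAdaptedEmbedding.lean) and
`stub_conjugateNewform` (Theorems/PhantomRMYoshidaSerreKWAutomorphicGL2ConjugateNewform.lean, p80281) are
theorems of the tree, imported above (same namespace). -/

/-! ## Stub 4 — LANDED
`stub_loweringKillsLift` (Theorems/PhantomRMYoshidaSerreKWAutomorphicGL2LoweringKillsLift.lean, p85192) is a theorem
of the tree, imported above (same namespace). -/

/-! ## Stub 5 — LANDED
`stub_adelicLiftIsCuspForm` (Theorems/PhantomRMYoshidaSerreKWAutomorphicGL2AdelicLiftIsCuspForm.lean, p82469) is a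
theorem of the tree, imported above (same namespace). -/

/-! ## Stub 6 — LANDED
`stub_archParameterOfGeneratedDatum` (Theorems/PhantomRMYoshidaSerreKWAutomorphicGL2ArchParameterOfGeneratedDatum.lean, p87174;
Literature bricks `CuspidalRepDataOfCuspFormInfChar` p82214, `GL2ArchParameterOfEigenform` p84083) is a theorem of the tree,
imported above (same namespace).  With it every provable stub is landed; the one remaining `sorry` is the named fact
`stub_khareWintenberger`, and the conditional assembly `SerreKWAutomorphicGL2_of_khareWintenberger` is landed as
Theorems/PhantomRMYoshidaSerreKWAutomorphicGL2.lean (p87561). -/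

/-! ## Stub 7 — LANDED
`stub_dictionaryL` (Theorems/PhantomRMYoshidaSerreKWAutomorphicGL2DictionaryL.lean, p82996) is a theorem of the
tree, imported above (same namespace). -/

/-! ## Glue lemmas (sorry-free) -/

/-- **The L-normalised Frobenius polynomial of the inverted roots is the polynomial itself.**  For
`ι : ℚ̄_p ≃+* ℂ` and a monic `P ∈ ℂ[X]` (which splits), `arithFrobPolyOfSatake ι q 1 (P.roots.map (·⁻¹))
= ∏_{β} (X - ι⁻¹((β⁻¹)⁻¹)) = ∏_{β} (X - ι⁻¹ β) = P.map ι⁻¹` — the `m = 1` twin of the tree's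
`arithFrobPolyOfSatake_heckeRoots` (`m = 2`); no non-vanishing of the roots is needed
(`(β⁻¹)⁻¹ = β` also for `β = 0`).  Buzzard–Gee's L-normalisation. [cite: BuzzardGeeLMS2014, §2.1] -/
theorem arithFrobPolyOfSatake_one_rootsInv {p : ℕ} [Fact p.Prime] (ι : PadicAlgCl p ≃+* ℂ)
    (q : ℕ) {P : ℂ[X]} (hP : P.Monic) :
    arithFrobPolyOfSatake ι q 1 (P.roots.map (·⁻¹)) = P.map (ι.symm : ℂ →+* PadicAlgCl p) := by
  rw [arithFrobPolyOfSatake_one, Multiset.map_map]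
  have hcard : Multiset.card P.roots = P.natDegree :=
    Polynomial.splits_iff_card_roots.mp (IsAlgClosed.splits P)
  trans (P.roots.map fun β ↦ (X - C β).map (ι.symm : ℂ →+* PadicAlgCl p)).prod
  · congr 1
    refine Multiset.map_congr rfl fun β _ ↦ ?_
    simp only [Function.comp_apply, inv_inv, Polynomial.map_sub, Polynomial.map_X, Polynomial.map_C]
    rfl
  · conv_rhs => rw [← Polynomial.prod_multiset_X_sub_C_of_monic_of_roots_card_eq hP hcard]
    rw [Polynomial.map_multiset_prod, Multiset.map_map]
    rfl

/-- The finite places of `ℚ` whose prime divides `n ≠ 0` form a finite set (`v ↦ p_v` is injective,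
`Rat.HeightOneSpectrum.primesEquiv`). [folklore] -/
theorem finite_setOf_primesEquiv_dvd {n : ℕ} (hn : n ≠ 0) :
    {v : HeightOneSpectrum (𝓞 ℚ) | ((Rat.HeightOneSpectrum.primesEquiv v : Nat.Primes) : ℕ) ∣ n}.Finite := by
  refine ((Set.finite_Iic n).preimage
    (f := fun v : HeightOneSpectrum (𝓞 ℚ) ↦ ((Rat.HeightOneSpectrum.primesEquiv v : Nat.Primes) : ℕ))
    ?_).subset ?_
  · intro v _ v' _ hvv'
    exact Rat.HeightOneSpectrum.primesEquiv.injective (Subtype.ext hvv')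
  · intro v hv
    exact Nat.le_of_dvd (Nat.pos_of_ne_zero hn) hv

/-- For `n ≠ 0`, almost every finite place `v` of `ℚ` has `p_v ∤ n`. [folklore] -/
theorem eventually_not_dvd {n : ℕ} (hn : n ≠ 0) :
    ∀ᶠ v : HeightOneSpectrum (𝓞 ℚ) in Filter.cofinite,
      ¬ ((Rat.HeightOneSpectrum.primesEquiv v : Nat.Primes) : ℕ) ∣ n := by
  rw [Filter.eventually_cofinite]
  simpa only [not_not] using finite_setOf_primesEquiv_dvd hn

/-- A newform is non-zero (`a₁ = 1`), hence so is its adelic lift (`exists_adelicLiftFun_ne_zero`: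
`|φ_f((y x; 0 1), 1)| = |f(x+iy)| y^{w/2}`). [cite: Gelbart1975, (3.4)] -/
theorem adelicLiftFunA_ne_zero_of_isNewform1 {M : ℕ} [NeZero M] {w : ℤ} {g : CuspForm (Gamma1 M) w}
    (hg : IsNewform1 g) : adelicLiftFunA M w ⇑g ≠ 0 := by
  have hg0 : g ≠ 0 := by
    rintro rfl
    have h1 := hg.2.2.2
    unfold IsNormalized at h1
    rw [CuspForm.coe_zero, UpperHalfPlane.qExpansion_zero, map_zero] at h1
    exact zero_ne_one h1
  have hex : ∃ τ₀ : UpperHalfPlane, g τ₀ ≠ 0 := by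
    by_contra h
    exact hg0 (DFunLike.ext g 0 fun τ₀ => by rw [not_exists.mp h τ₀ |> not_not.mp]; rfl)
  obtain ⟨x, -, hx⟩ := exists_adelicLiftFun_ne_zero (N := M) (k := w) g hex
  intro h0
  apply hx
  have h1 : adelicLiftFunA M w ⇑g (Rat.ofRealGL 2 x) = 0 := by rw [h0]; rfl
  simpa using h1

/-! ## The composition: the seven stubs imply the crux BY NAME -/

/-- **`SerreKWAutomorphicGL2` from the seven stubs** (kernel-checked glue, no `sorry` outside the
stubs).  Fix `p, k, red, σ̄` odd irreducible, `hcpt₂`, `ι`.  Stub 1 (KW): a newform `f` of weight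
`w ≥ 2`, level `N`, and `ι_f : 𝓞_f → k` with `charpoly σ̄(Frob_q) = ι_f(P_q)`, `P_q ↦ H_q(f)`, for
`q ∤ Np`.  Stub 2: `τ : K_f → ℂ`, `θ : 𝓞_f → 𝒪_{ℚ̄_p}` with `θ = ι⁻¹τ` on `𝓞_f`, `red ∘ θ = ι_f`.
Stub 3: a newform `g` of weight `w`, level `M`, with `H_q(g) = τ(H_q(f))` in `ℂ[X]` for `q ∤ NM`.
Stubs 4, 5, 6, 7 applied to `g`: an L-algebraic cuspidal `π₂` on `GL₂(𝔸_ℚ)` with Satake multiset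
`H_q(g).roots⁻¹` a.e.  At every `v` outside the three finite exceptional sets put
`P := θ(P_q) ∈ 𝒪_{ℚ̄_p}[X]`, `Pb := ι_f(P_q)`: then `P ↦ ι⁻¹τ(P_q ↦ K_f) = ι⁻¹(τ H_q(f)) = ι⁻¹ H_q(g)
= arithFrobPolyOfSatake ι q 1 (H_q(g).roots⁻¹)` (`arithFrobPolyOfSatake_one_rootsInv`) and
`P mod 𝔪 = red(θ P_q) = ι_f(P_q) = Pb = charpoly σ̄(Frob_v)`, with `σ̄` unramified at `v`. -/
theorem SerreKWAutomorphicGL2_of :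
    Summit.Langlands.Langlands.Theses.PhantomRMYoshida.SerreKWAutomorphicGL2 := by
  intro p _ k _ _ _ _ _ red σ hodd hirr hcpt₂ ι
  -- (A) Galois side: KW (the named fact, Stub 1, through its weak form), alignment, conjugation
  obtain ⟨N, _instN, w, hw, f, ιf, hf, hKW⟩ :=
    serreModularityTwoLe_of_khareWintenberger stub_khareWintenberger p k σ hodd hirr
  obtain ⟨τ, θ, hθ, hred⟩ := stub_residueAdaptedEmbedding p k red ι N _ f hf ιf
  obtain ⟨M, _instM, g, hg, hconj⟩ := stub_conjugateNewform N _ f hf τ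
  -- (B) automorphic side for the conjugate newform `g`
  have hw' : (2 : ℤ) ≤ ((w : ℕ) : ℤ) := by exact_mod_cast hw
  obtain ⟨hsm, hlow⟩ := stub_loweringKillsLift M _ g hcpt₂
  have hφ : adelicLiftFunA M (w : ℤ) ⇑g ∈ cuspFormsGL 2 ℚ hcpt₂ :=
    (stub_adelicLiftIsCuspForm M _ hw' g hcpt₂ hsm hlow).mem_cuspFormsGL
  have hφ0 : adelicLiftFunA M (w : ℤ) ⇑g ≠ 0 := adelicLiftFunA_ne_zero_of_isNewform1 hg
  have harch := stub_archParameterOfGeneratedDatum M _ g hcpt₂ hlow hφ hφ0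
  obtain ⟨π₂, hL, hsat₂⟩ :=
    stub_dictionaryL M _ hw' g hg hcpt₂ (CuspidalAutomorphicRepData.ofCuspForm hφ hφ0)
      (CuspidalAutomorphicRepData.mem_W_ofCuspForm hφ hφ0)
      (CuspidalAutomorphicRepData.not_mem_W'_ofCuspForm hφ hφ0) harch
  refine ⟨π₂, hL, ?_⟩
  -- the three finite exceptional sets
  have hp : p.Prime := Fact.out
  have hgoodNp := eventually_not_dvd (n := N * p) (mul_ne_zero (NeZero.ne N) hp.ne_zero)
  have hgoodNM := eventually_not_dvd (n := N * M) (mul_ne_zero (NeZero.ne N) (NeZero.ne M))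
  filter_upwards [hsat₂, hgoodNp, hgoodNM] with v hv hvNp hvNM
  -- KW's local clause at `v`
  obtain ⟨hunr, Pint, hPint, hFrob⟩ := hKW v hvNp
  refine ⟨_, Pint.map θ, Pint.map ιf, hv, ?_, hunr, hFrob, ?_⟩
  · -- integrality transport + the root-form identity
    have hmonic : ((heckePolynomial g ((Rat.HeightOneSpectrum.primesEquiv v : Nat.Primes) : ℕ)).map
        (algebraMap (coeffCharField g) ℂ)).Monic :=
      (monic_heckePolynomial g _).map _
    have hθ' : (Valued.integer (PadicAlgCl p)).subtype.comp θ =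
        ((ι.symm : ℂ →+* PadicAlgCl p).comp τ).comp
          (algebraMap (coeffCharIntegers f) (coeffCharField f)) :=
      RingHom.ext fun x => hθ x
    rw [arithFrobPolyOfSatake_one_rootsInv ι _ hmonic,
      hconj _ (Rat.HeightOneSpectrum.primesEquiv v).2 hvNM]
    simp only [Polynomial.map_map]
    rw [← hPint, Polynomial.map_map, hθ']
  · rw [Polynomial.map_map]
    exact congrArg (fun F : coeffCharIntegers f →+* k => Pint.map F) (RingHom.ext hred)

end Summit.Langlands.Langlands.Cruxes.SerreKWAutomorphicGL2.AdelicNewformDatumDoubleTwist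

end
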